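import Literature.Analysis.SpecialFunctions.RiemannThetaHeatEquation
import Literature.Analysis.SpecialFunctions.RiemannThetaTypeDBasePointFree
import HarnessLib

/-!
# The `τ`-gradient of the theta constants: Grushevsky–Salvati Manni's operator `𝒟`, the heat
# equation in matrix form, the brackets `B(θ, θ')`, and a non-vanishing even theta constant

Topic `Literature/Analysis/SpecialFunctions`, namespace `Literature.Analysis.SpecialFunctions` (lane
`lit-hodgefound`, Layer A4, theta-divisor row A4-17; prover seat `lit-hodgefound-p23`, row «A4-17(n)»,
FILE G1). Sequel of `RiemannThetaHeatEquation.lean` (Lange–Birkenhake Prop. 3.3.7, the heat equation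
for `ϑ[a; b]`) and the analytic half of the heat-equation form of the Hessian-rank strata `θ_null^h`
of Grushevsky–Salvati Manni (`Literature/Geometry/Kaehler/SiegelTorusThetaNullRank.lean`; the torus
readings are FILE G2, `Literature/Geometry/Kaehler/SiegelTorusThetaNullGradient.lean`).

Source followed (held text, read at the quoted chunks): S. Grushevsky, R. Salvati Manni, *Jacobians
with a vanishing theta-null in genus 4*, Israel J. Math. 164 (2008) [held `paper:arxiv-math_0605160`]:

* p0005 **Dsc 8**: "Since theta functions satisfy the heat equation
  `∂²θ[ε,δ](τ,z)/∂zᵢ∂zⱼ = πi(1+δᵢⱼ) ∂θ[ε,δ](τ,z)/∂τᵢⱼ` (where `δᵢⱼ` is Krönecker's delta), the Hessian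
  of the theta functions with respect to `z` can be rewritten as the first derivatives with respect to
  `τᵢⱼ`. Hence if a point `x = τε/2 + δ/2` of order two is a singular point in the theta divisor …, the
  rank of the quadric defining the tangent cone at `x` is the rank of the matrix obtained by applying the
  `g × g`-matrix-valued differential operator
  `𝒟 := (∂/∂τ₁₁, ½∂/∂τ₁₂, …, ½∂/∂τ₁g; ½∂/∂τ₂₁, ∂/∂τ₂₂, …, ½∂/∂τ₂g; …; ½∂/∂τ_g1, …, ∂/∂τ_gg)`
  to `θ[ε,δ](τ,0)`."
* p0006 §2: "for any even characteristic `[ε,δ] ≠ [0,0]` the expression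
  `θ[ε,δ](τ)² 𝒟(θ00/θ[ε,δ])(τ) = (1+δᵢⱼ)[θ[ε,δ](τ) ∂θ00(τ)/∂τᵢⱼ − θ00(τ) ∂θ[ε,δ](τ)/∂τᵢⱼ]` …",
  the matrix whose minors `B(θ00, θ[ε,δ])^h` give the set-theoretic equations of `θ_0^h` (Theorem 9),
  and, in the proof of Theorem 9, "there always exists an even characteristic `[ε,δ]` such that
  `θ[ε,δ](τ) ≠ 0`".

Normalisations. The tree's (and GSM's) theta function is `ϑ[a;b](z, Ω) = Σ_m exp(πi ᵗ(m+a)Ω(m+a) +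
2πi ᵗ(m+a)(z+b))`; in it the heat equation reads `∂²ϑ/∂zᵢ∂zⱼ = 2πi · d/dt|₀ ϑ(z, Ω + t(Eᵢⱼ + Eⱼᵢ))
= 2πi(1+δᵢⱼ) ∂ϑ/∂τᵢⱼ` (the tree's `riemannThetaChar_heat_equation_single_add_single`; for `g = 1` this is
Jacobi's `∂²ϑ/∂z² = 4πi ∂ϑ/∂τ`), so the printed constant `πi(1+δᵢⱼ)` of Dsc 8 is `2πi(1+δᵢⱼ)` here and
the matrix identity below is `Hessian = 4πi · 𝒟ϑ`; likewise the displayed quotient-rule identity of §2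
holds with a factor `½` on the right (`θ'² 𝒟(θ/θ') = ½ B(θ, θ')`). Both constants are immaterial for the
ranks and zero loci the paper (and FILE G2) use.

What is here (two definitions with bodies, theorems; no named fact, net debt `0`).

* **`dOp f Ω`** — GSM's operator `𝒟` applied to a function `f` of the period matrix at `Ω`:
  `(𝒟f)ᵢⱼ := ½ · d/dt|_{t=0} f(Ω + t(Eᵢⱼ + Eⱼᵢ))`, i.e. `∂f/∂τᵢᵢ` on the diagonal and `½ ∂f/∂τᵢⱼ` off
  it (`τᵢⱼ = τⱼᵢ`, `i < j`, the coordinates of the symmetric matrices); `dOp_apply`, `isSymm_dOp`, the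
  Fréchet forms `dOp_apply_eq_fderiv` / `dOp_apply_same_eq_fderiv`, `dOp_const_mul`, the Leibniz and
  quotient rules `dOp_mul`, `dOp_div`.
* **`dOpBracket f f' Ω`** — the matrix `(1+δᵢⱼ)[f'(Ω) ∂f/∂τᵢⱼ(Ω) − f(Ω) ∂f'/∂τᵢⱼ(Ω)]` of §2
  (`(1+δᵢⱼ)∂/∂τᵢⱼ = d/dt|₀` along `Eᵢⱼ + Eⱼᵢ`); `dOpBracket_eq_two_smul`
  (`B(f,f') = 2(f'(Ω)•𝒟f − f(Ω)•𝒟f')`), `dOpBracket_self`, `dOpBracket_swap`, at a zero of `f`: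
  `dOpBracket_eq_smul_dOp_of_eq_zero` (`B(f,f')(Ω) = 2f'(Ω) • 𝒟f(Ω)`),
  `rank_dOpBracket_eq_of_eq_zero` / `rank_dOpBracket_le_of_eq_zero`, and GSM's display
  `sq_smul_dOp_div_eq` (`f'(Ω)² 𝒟(f/f')(Ω) = ½ B(f,f')(Ω)`).
* **The heat equation in matrix form** (Dsc 8): `hessian_riemannThetaChar_eq_smul_dOp` — for symmetric
  `Ω` with `Im Ω ≥ c > 0` and all `a b z ∈ ℂ^g`, the Hessian `(∂ᵢ∂ⱼϑ[a;b](·, Ω)(z))ᵢⱼ` equals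
  `(4πi) • 𝒟(ϑ[a;b](z, ·))(Ω)`; hence **`rank_hessian_riemannThetaChar_eq_rank_dOp`** ("the rank of the
  quadric defining the tangent cone at `x` is the rank of the matrix `𝒟θ[ε,δ](τ,0)`") and
  `hessian_riemannThetaChar_eq_zero_iff_dOp_eq_zero`; versions on the Siegel upper half space and for
  `ϑ = ϑ[0;0]`.
* **A non-vanishing even theta constant** (proof of Theorem 9): `exists_riemannThetaChar_half_ne_zero_snd`
  — for `Ω` symmetric with `Im Ω` positive definite and EVERY `l ∈ ℤ^g` there is `k ∈ {0,1}^g` with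
  `ϑ[k/2; l/2](0, Ω) ≠ 0` (base-point freeness of `L₀²`, Lange Prop. 2.1.5, the tree's
  `exists_riemannThetaChar_typeD_apply_ne_zero_of_posDef` at `v = l/2`, through `ϑ[a;b](z) = ϑ[a;0](z+b)`);
  such a characteristic is necessarily even (odd theta constants vanish — `riemannThetaChar_half_zero_of_odd`
  in `Literature/Geometry/Kaehler/SiegelTorusThetaParity.lean`; used in FILE G2).
* **`𝒟ϑ` is the matrix of partial derivatives `(∂ϑ/∂Ωᵢⱼ)` on all of `M_g(ℂ)`** (§5):
  `fderiv_riemannThetaChar_omega_apply_eq_symmetrize` (the `Ω`-differential of `ϑ[a;b](z,·)` only sees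
  the symmetric part of the direction), `dOp_riemannThetaChar_apply_eq_fderiv_single`
  (`(𝒟ϑ)ᵢⱼ(Ω) = D_Ω ϑ(Ω)[Eᵢⱼ]`), `dOp_riemannThetaChar_eq_zero_iff_fderiv_eq_zero` (`𝒟ϑ(Ω) = 0` iff the
  whole `Ω`-differential vanishes).

Not here: the modularity of `θ[ε,δ]² 𝒟(θ00/θ[ε,δ])` and of `B^h` (vector-valued modular forms for
`Γ_g(4,8)`), the loci `θ_null^h ⊂ 𝒜_g(4,8)` as varieties.

## References

* [GrushevskySalvatiManni2008] S. Grushevsky, R. Salvati Manni, *Jacobians with a vanishing theta-null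
  in genus 4*, Israel J. Math. 164 (2008), 303–315 (arXiv:math/0605160), Dsc 8, §2, Theorem 9.
* [LangeBirkenhake1992] H. Lange, Ch. Birkenhake, *Complex Abelian Varieties*, §3.3.2 Prop. 3.3.7.
* [Lange2023AbelianVarietiesComplex] H. Lange, *Abelian Varieties over the Complex Numbers* (2023),
  §2.1.1 Prop. 2.1.5.
* [MumfordTata1] D. Mumford, *Tata Lectures on Theta I*, Ch. II §1.
-/

noncomputable section

open Complex Real Finset Filter Topology Matrix
open scoped Matrix.Norms.Elementwise

namespace Literature.Analysis.SpecialFunctions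

open Literature.NumberTheory.Automorphic (siegelUpperHalfSpace)

variable {g : ℕ}

/-! ### §1 Grushevsky–Salvati Manni's operator `𝒟` -/

/-- **Grushevsky–Salvati Manni's `g × g`-matrix-valued differential operator `𝒟`** applied to a
function `f` of the period matrix, at `Ω`: `(𝒟f)ᵢⱼ(Ω) = ½ · d/dt|_{t=0} f(Ω + t(Eᵢⱼ + Eⱼᵢ))` — on the
diagonal this is `∂f/∂τᵢᵢ`, off the diagonal `½ ∂f/∂τᵢⱼ` (`τᵢⱼ = τⱼᵢ` the coordinate of the symmetric
matrices, whose coordinate direction is `Eᵢⱼ + Eⱼᵢ`): "the `g × g`-matrix-valued differential operator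
`𝒟 := (∂/∂τ₁₁, ½∂/∂τ₁₂, …; …; ½∂/∂τ_g1, …, ∂/∂τ_gg)`".
[cite: GrushevskySalvatiManni2008, Dsc 8 (p0005 of the held text)] -/
def dOp (f : Matrix (Fin g) (Fin g) ℂ → ℂ) (Ω : Matrix (Fin g) (Fin g) ℂ) : Matrix (Fin g) (Fin g) ℂ :=
  Matrix.of fun i j ↦
    2⁻¹ * deriv (fun t : ℂ ↦ f (Ω + t • (Matrix.single i j (1 : ℂ) + Matrix.single j i 1))) 0

/-- Unfolding of `dOp`. [cite: GrushevskySalvatiManni2008, Dsc 8 (p0005 of the held text)] -/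
theorem dOp_apply (f : Matrix (Fin g) (Fin g) ℂ → ℂ) (Ω : Matrix (Fin g) (Fin g) ℂ) (i j : Fin g) :
    dOp f Ω i j =
      2⁻¹ * deriv (fun t : ℂ ↦ f (Ω + t • (Matrix.single i j (1 : ℂ) + Matrix.single j i 1))) 0 :=
  rfl

/-- `𝒟f(Ω)` is a symmetric matrix (the direction `Eᵢⱼ + Eⱼᵢ` is symmetric in `i, j`).
[cite: GrushevskySalvatiManni2008, Dsc 8 (p0005 of the held text)] -/
theorem dOp_apply_comm (f : Matrix (Fin g) (Fin g) ℂ → ℂ) (Ω : Matrix (Fin g) (Fin g) ℂ) (i j : Fin g) :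
    dOp f Ω i j = dOp f Ω j i := by
  rw [dOp_apply, dOp_apply, add_comm (Matrix.single i j (1 : ℂ))]

/-- `𝒟f(Ω)` is symmetric. [cite: GrushevskySalvatiManni2008, Dsc 8 (p0005 of the held text)] -/
theorem isSymm_dOp (f : Matrix (Fin g) (Fin g) ℂ → ℂ) (Ω : Matrix (Fin g) (Fin g) ℂ) :
    (dOp f Ω).IsSymm :=
  Matrix.IsSymm.ext fun i j ↦ dOp_apply_comm f Ω j i

/-- The derivative along a line through a Fréchet-differentiable point. [folklore] -/
private theorem hasDerivAt_line {f : Matrix (Fin g) (Fin g) ℂ → ℂ} {Ω : Matrix (Fin g) (Fin g) ℂ}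
    (hf : DifferentiableAt ℂ f Ω) (S : Matrix (Fin g) (Fin g) ℂ) :
    HasDerivAt (fun t : ℂ ↦ f (Ω + t • S)) (fderiv ℂ f Ω S) 0 := by
  have h := hf.hasFDerivAt.comp_hasDerivAt_of_eq 0
    (((hasDerivAt_id (0 : ℂ)).smul_const S).const_add Ω) (by simp only [id_eq, zero_smul, add_zero])
  simp only [id_eq, one_smul, Function.comp_def] at h
  exact h

/-- The line through a Fréchet-differentiable point is differentiable at `t = 0`. [folklore] -/
private theorem differentiableAt_line {f : Matrix (Fin g) (Fin g) ℂ → ℂ} {Ω : Matrix (Fin g) (Fin g) ℂ}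
    (hf : DifferentiableAt ℂ f Ω) (S : Matrix (Fin g) (Fin g) ℂ) :
    DifferentiableAt ℂ (fun t : ℂ ↦ f (Ω + t • S)) 0 :=
  (hasDerivAt_line hf S).differentiableAt

/-- **Fréchet form**: at a point where `f` is (Fréchet) complex-differentiable,
`(𝒟f)ᵢⱼ(Ω) = ½ Df(Ω)[Eᵢⱼ + Eⱼᵢ]`. [cite: GrushevskySalvatiManni2008, Dsc 8 (p0005 of the held text)] -/
theorem dOp_apply_eq_fderiv {f : Matrix (Fin g) (Fin g) ℂ → ℂ} {Ω : Matrix (Fin g) (Fin g) ℂ}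
    (hf : DifferentiableAt ℂ f Ω) (i j : Fin g) :
    dOp f Ω i j = 2⁻¹ * fderiv ℂ f Ω (Matrix.single i j (1 : ℂ) + Matrix.single j i 1) := by
  rw [dOp_apply, (hasDerivAt_line hf _).deriv]

/-- **The diagonal entries are the partial derivatives `∂f/∂τᵢᵢ`**: `(𝒟f)ᵢᵢ(Ω) = Df(Ω)[Eᵢᵢ]`
("`𝒟 := (∂/∂τ₁₁, ½∂/∂τ₁₂, …)`"). [cite: GrushevskySalvatiManni2008, Dsc 8 (p0005 of the held text)] -/
theorem dOp_apply_same_eq_fderiv {f : Matrix (Fin g) (Fin g) ℂ → ℂ} {Ω : Matrix (Fin g) (Fin g) ℂ}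
    (hf : DifferentiableAt ℂ f Ω) (i : Fin g) :
    dOp f Ω i i = fderiv ℂ f Ω (Matrix.single i i (1 : ℂ)) := by
  rw [dOp_apply_eq_fderiv hf, ← two_smul ℂ (Matrix.single i i (1 : ℂ)), map_smul, smul_eq_mul,
    ← mul_assoc, inv_mul_cancel₀ two_ne_zero, one_mul]

/-- `𝒟(c·f) = c · 𝒟f` (no differentiability needed). [cite: GrushevskySalvatiManni2008, Dsc 8 (p0005 of the held text)] -/
theorem dOp_const_mul (c : ℂ) (f : Matrix (Fin g) (Fin g) ℂ → ℂ) (Ω : Matrix (Fin g) (Fin g) ℂ) :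
    dOp (fun Ω' ↦ c * f Ω') Ω = c • dOp f Ω := by
  ext i j
  simp only [dOp_apply, Matrix.smul_apply, smul_eq_mul]
  rw [show (fun t : ℂ ↦ c * f (Ω + t • (Matrix.single i j (1 : ℂ) + Matrix.single j i 1))) =
      fun t : ℂ ↦ c * (fun s : ℂ ↦ f (Ω + s • (Matrix.single i j (1 : ℂ) + Matrix.single j i 1))) t
      from rfl, deriv_const_mul_field']
  ring

/-- **Leibniz rule for `𝒟`**: `𝒟(f·h)(Ω) = h(Ω)•𝒟f(Ω) + f(Ω)•𝒟h(Ω)` at a point where `f` and `h` are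
complex-differentiable. [cite: GrushevskySalvatiManni2008, §2 (p0006 of the held text)] -/
theorem dOp_mul {f h : Matrix (Fin g) (Fin g) ℂ → ℂ} {Ω : Matrix (Fin g) (Fin g) ℂ}
    (hf : DifferentiableAt ℂ f Ω) (hh : DifferentiableAt ℂ h Ω) :
    dOp (fun Ω' ↦ f Ω' * h Ω') Ω = h Ω • dOp f Ω + f Ω • dOp h Ω := by
  ext i j
  simp only [dOp_apply, Matrix.add_apply, Matrix.smul_apply, smul_eq_mul]
  set S : Matrix (Fin g) (Fin g) ℂ := Matrix.single i j (1 : ℂ) + Matrix.single j i 1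
  have hmul := ((hasDerivAt_line hf S).mul (hasDerivAt_line hh S)).deriv
  simp only [zero_smul, add_zero] at hmul
  rw [show (fun t : ℂ ↦ f (Ω + t • S) * h (Ω + t • S)) =
      ((fun t : ℂ ↦ f (Ω + t • S)) * fun t : ℂ ↦ h (Ω + t • S)) from rfl, hmul,
    (hasDerivAt_line hf S).deriv, (hasDerivAt_line hh S).deriv]
  ring

/-- **Quotient rule for `𝒟`**: `𝒟(f/h)(Ω) = (h(Ω)•𝒟f(Ω) − f(Ω)•𝒟h(Ω)) / h(Ω)²` where `h(Ω) ≠ 0`.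
[cite: GrushevskySalvatiManni2008, §2 (p0006 of the held text)] -/
theorem dOp_div {f h : Matrix (Fin g) (Fin g) ℂ → ℂ} {Ω : Matrix (Fin g) (Fin g) ℂ}
    (hf : DifferentiableAt ℂ f Ω) (hh : DifferentiableAt ℂ h Ω) (h0 : h Ω ≠ 0) :
    dOp (fun Ω' ↦ f Ω' / h Ω') Ω = (h Ω ^ 2)⁻¹ • (h Ω • dOp f Ω - f Ω • dOp h Ω) := by
  ext i j
  simp only [dOp_apply, Matrix.sub_apply, Matrix.smul_apply, smul_eq_mul]
  set S : Matrix (Fin g) (Fin g) ℂ := Matrix.single i j (1 : ℂ) + Matrix.single j i 1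
  have h0' : h (Ω + (0 : ℂ) • S) ≠ 0 := by rwa [zero_smul, add_zero]
  have hdiv := ((hasDerivAt_line hf S).div (hasDerivAt_line hh S) h0').deriv
  simp only [zero_smul, add_zero] at hdiv
  rw [show (fun t : ℂ ↦ f (Ω + t • S) / h (Ω + t • S)) =
      ((fun t : ℂ ↦ f (Ω + t • S)) / fun t : ℂ ↦ h (Ω + t • S)) from rfl, hdiv,
    (hasDerivAt_line hf S).deriv, (hasDerivAt_line hh S).deriv]
  field_simp

/-! ### §2 The brackets `B(f, f')` -/

/-- **Grushevsky–Salvati Manni's bracket** of two functions of the period matrix: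
`B(f, f')ᵢⱼ(Ω) = (1+δᵢⱼ)[f'(Ω) ∂f/∂τᵢⱼ(Ω) − f(Ω) ∂f'/∂τᵢⱼ(Ω)]`, where `(1+δᵢⱼ)∂/∂τᵢⱼ = d/dt|_{t=0}` along
`Ω + t(Eᵢⱼ + Eⱼᵢ)`; for `f = θ00`, `f' = θ[ε,δ]` this is the matrix whose `h × h` minors form
`B(θ00, θ[ε,δ])^h` ("the expression `θ[ε,δ](τ)² 𝒟(θ00/θ[ε,δ])(τ) =
(1+δᵢⱼ)[θ[ε,δ](τ) ∂θ00(τ)/∂τᵢⱼ − θ00(τ) ∂θ[ε,δ](τ)/∂τᵢⱼ]`").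
[cite: GrushevskySalvatiManni2008, §2 (p0006 of the held text)] -/
def dOpBracket (f f' : Matrix (Fin g) (Fin g) ℂ → ℂ) (Ω : Matrix (Fin g) (Fin g) ℂ) :
    Matrix (Fin g) (Fin g) ℂ :=
  Matrix.of fun i j ↦
    f' Ω * deriv (fun t : ℂ ↦ f (Ω + t • (Matrix.single i j (1 : ℂ) + Matrix.single j i 1))) 0 -
      f Ω * deriv (fun t : ℂ ↦ f' (Ω + t • (Matrix.single i j (1 : ℂ) + Matrix.single j i 1))) 0

/-- Unfolding of `dOpBracket`. [cite: GrushevskySalvatiManni2008, §2 (p0006 of the held text)] -/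
theorem dOpBracket_apply (f f' : Matrix (Fin g) (Fin g) ℂ → ℂ) (Ω : Matrix (Fin g) (Fin g) ℂ)
    (i j : Fin g) :
    dOpBracket f f' Ω i j =
      f' Ω * deriv (fun t : ℂ ↦ f (Ω + t • (Matrix.single i j (1 : ℂ) + Matrix.single j i 1))) 0 -
        f Ω * deriv (fun t : ℂ ↦ f' (Ω + t • (Matrix.single i j (1 : ℂ) + Matrix.single j i 1))) 0 :=
  rfl

/-- **`B(f, f') = 2(f'(Ω) • 𝒟f(Ω) − f(Ω) • 𝒟f'(Ω))`** (`(1+δᵢⱼ)∂/∂τᵢⱼ = 2𝒟ᵢⱼ`).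
[cite: GrushevskySalvatiManni2008, §2 (p0006 of the held text)] -/
theorem dOpBracket_eq_two_smul (f f' : Matrix (Fin g) (Fin g) ℂ → ℂ) (Ω : Matrix (Fin g) (Fin g) ℂ) :
    dOpBracket f f' Ω = (2 : ℂ) • (f' Ω • dOp f Ω - f Ω • dOp f' Ω) := by
  ext i j
  simp only [dOpBracket_apply, dOp_apply, Matrix.smul_apply, Matrix.sub_apply, smul_eq_mul]
  ring

/-- `B(f, f) = 0`. [cite: GrushevskySalvatiManni2008, §2 (p0006 of the held text)] -/
theorem dOpBracket_self (f : Matrix (Fin g) (Fin g) ℂ → ℂ) (Ω : Matrix (Fin g) (Fin g) ℂ) :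
    dOpBracket f f Ω = 0 := by
  ext i j
  simp only [dOpBracket_apply, Matrix.zero_apply, sub_self]

/-- `B(f', f) = −B(f, f')`. [cite: GrushevskySalvatiManni2008, §2 (p0006 of the held text)] -/
theorem dOpBracket_swap (f f' : Matrix (Fin g) (Fin g) ℂ → ℂ) (Ω : Matrix (Fin g) (Fin g) ℂ) :
    dOpBracket f' f Ω = -dOpBracket f f' Ω := by
  ext i j
  simp only [dOpBracket_apply, Matrix.neg_apply, neg_sub]

/-- **At a zero of `f` the bracket is a multiple of the `τ`-gradient**: `f(Ω) = 0 ⟹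
B(f, f')(Ω) = 2f'(Ω) • 𝒟f(Ω)` (the restriction to `{f = 0}` in GSM's "the derivative of a section of a
bundle is only a section of that bundle when restricted to the zero set of the section").
[cite: GrushevskySalvatiManni2008, §2 (p0006 of the held text)] -/
theorem dOpBracket_eq_smul_dOp_of_eq_zero {f : Matrix (Fin g) (Fin g) ℂ → ℂ}
    (f' : Matrix (Fin g) (Fin g) ℂ → ℂ) {Ω : Matrix (Fin g) (Fin g) ℂ} (h0 : f Ω = 0) :
    dOpBracket f f' Ω = (2 * f' Ω) • dOp f Ω := by
  ext i j
  simp only [dOpBracket_apply, dOp_apply, Matrix.smul_apply, smul_eq_mul, h0, zero_mul, sub_zero]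
  ring

/-- `rank (c • A) = rank A` for `c ≠ 0`. [folklore] -/
private theorem rank_smul_of_ne_zero {m : Type*} [Fintype m] [DecidableEq m] {c : ℂ} (hc : c ≠ 0)
    (A : Matrix m m ℂ) : (c • A).rank = A.rank := by
  refine le_antisymm ?_ ?_
  · rw [Matrix.smul_eq_diagonal_mul]
    exact Matrix.rank_mul_le_right _ _
  · conv_lhs => rw [show A = c⁻¹ • (c • A) by rw [smul_smul, inv_mul_cancel₀ hc, one_smul]]
    rw [Matrix.smul_eq_diagonal_mul]
    exact Matrix.rank_mul_le_right _ _

/-- **At a zero of `f` where `f'(Ω) ≠ 0`, `rank B(f, f')(Ω) = rank 𝒟f(Ω)`** (the step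
"`B(θ00, θ[ε,δ])^{h+1}(τ) = 0` implies `τ ∈ θ_0^h`" of the proof of Theorem 9).
[cite: GrushevskySalvatiManni2008, §2 Theorem 9 (p0006 of the held text)] -/
theorem rank_dOpBracket_eq_of_eq_zero {f f' : Matrix (Fin g) (Fin g) ℂ → ℂ}
    {Ω : Matrix (Fin g) (Fin g) ℂ} (h0 : f Ω = 0) (h0' : f' Ω ≠ 0) :
    (dOpBracket f f' Ω).rank = (dOp f Ω).rank := by
  rw [dOpBracket_eq_smul_dOp_of_eq_zero f' h0, rank_smul_of_ne_zero (mul_ne_zero two_ne_zero h0')]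

/-- **At a zero of `f`, `rank B(f, f')(Ω) ≤ rank 𝒟f(Ω)`** for every `f'` (equality if `f'(Ω) ≠ 0`, and
`B = 0` if `f'(Ω) = 0`) — "one implication is trivial" in Theorem 9.
[cite: GrushevskySalvatiManni2008, §2 Theorem 9 (p0006 of the held text)] -/
theorem rank_dOpBracket_le_of_eq_zero {f : Matrix (Fin g) (Fin g) ℂ → ℂ}
    (f' : Matrix (Fin g) (Fin g) ℂ → ℂ) {Ω : Matrix (Fin g) (Fin g) ℂ} (h0 : f Ω = 0) :
    (dOpBracket f f' Ω).rank ≤ (dOp f Ω).rank := by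
  by_cases h0' : f' Ω = 0
  · rw [dOpBracket_eq_smul_dOp_of_eq_zero f' h0, h0', mul_zero, zero_smul, Matrix.rank_zero]
    exact Nat.zero_le _
  · exact (rank_dOpBracket_eq_of_eq_zero h0 h0').le

/-- **GSM's display `θ[ε,δ](τ)² 𝒟(θ00/θ[ε,δ])(τ) = (1+δᵢⱼ)[θ[ε,δ] ∂θ00/∂τᵢⱼ − θ00 ∂θ[ε,δ]/∂τᵢⱼ]`**,
in the form that holds with the paper's own `𝒟` (diagonal `∂/∂τᵢᵢ`, off-diagonal `½∂/∂τᵢⱼ`):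
`f'(Ω)² • 𝒟(f/f')(Ω) = ½ • B(f, f')(Ω)` at a point where `f, f'` are complex-differentiable and
`f'(Ω) ≠ 0` (the display omits the factor `½ = 𝒟ᵢⱼ / ((1+δᵢⱼ)∂/∂τᵢⱼ)`; immaterial for the minors'
zero loci). [cite: GrushevskySalvatiManni2008, §2 (p0006 of the held text)] -/
theorem sq_smul_dOp_div_eq {f f' : Matrix (Fin g) (Fin g) ℂ → ℂ} {Ω : Matrix (Fin g) (Fin g) ℂ}
    (hf : DifferentiableAt ℂ f Ω) (hf' : DifferentiableAt ℂ f' Ω) (h0' : f' Ω ≠ 0) :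
    (f' Ω ^ 2) • dOp (fun Ω' ↦ f Ω' / f' Ω') Ω = (2 : ℂ)⁻¹ • dOpBracket f f' Ω := by
  rw [dOp_div hf hf' h0', dOpBracket_eq_two_smul, smul_smul, mul_inv_cancel₀ (pow_ne_zero 2 h0'),
    one_smul, smul_smul, inv_mul_cancel₀ two_ne_zero, one_smul]

/-! ### §3 The heat equation in matrix form: `Hessian = 4πi · 𝒟ϑ` -/

/-- **`Ω ↦ ϑ[a; b](z, Ω)` is complex-differentiable at every symmetric `Ω` with `Im Ω ≥ c > 0`** (the
`Ω`-direction of Lange–Birkenhake Prop. 3.3.6). [cite: LangeBirkenhake1992, §3.3.2 Prop. 3.3.6] -/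
theorem differentiableAt_riemannThetaChar_omega (Ω : Matrix (Fin g) (Fin g) ℂ) {c : ℝ} (hc : 0 < c)
    (hY : ∀ x : Fin g → ℝ, c * ∑ i, x i ^ 2 ≤ ∑ i, ∑ j, x i * (Ω i j).im * x j)
    (a b z : Fin g → ℂ) :
    DifferentiableAt ℂ (fun Ω' : Matrix (Fin g) (Fin g) ℂ ↦ riemannThetaChar a b Ω' z) Ω :=
  (differentiableAt_riemannThetaChar_prod a b Ω hc hY z).comp Ω
    ((differentiableAt_const z).prodMk differentiableAt_id)

/-- **`Ω ↦ ϑ[a; b](z, Ω)` is complex-differentiable at every point of `𝔥_g`.**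
[cite: LangeBirkenhake1992, §3.3.2 Prop. 3.3.6] -/
theorem differentiableAt_riemannThetaChar_omega_of_mem_siegelUpperHalfSpace
    {Ω : Matrix (Fin g) (Fin g) ℂ} (hΩ : Ω ∈ siegelUpperHalfSpace g) (a b z : Fin g → ℂ) :
    DifferentiableAt ℂ (fun Ω' : Matrix (Fin g) (Fin g) ℂ ↦ riemannThetaChar a b Ω' z) Ω := by
  obtain ⟨c, hc, hY⟩ := exists_pos_mul_sum_sq_le_of_posDef_im Ω hΩ.2
  exact differentiableAt_riemannThetaChar_omega Ω hc hY a b z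

/-- **Dsc 8 — the heat equation in matrix form: the Hessian of `ϑ[a;b](·, Ω)` at `z` is `4πi` times the
`τ`-gradient `𝒟(ϑ[a;b](z, ·))(Ω)`** ("the Hessian of the theta functions with respect to `z` can be
rewritten as the first derivatives with respect to `τᵢⱼ`"): for symmetric `Ω` with `Im Ω ≥ c > 0` and all
`a b z ∈ ℂ^g`, `(∂ᵢ∂ⱼϑ[a;b](·,Ω)(z))ᵢⱼ = (4πi) • 𝒟(ϑ[a;b](z,·))(Ω)`. (Entrywise this is the tree's
`∂ᵢ∂ⱼϑ = 2πi · d/dt|₀ ϑ(z, Ω + t(Eᵢⱼ + Eⱼᵢ)) = 2πi(1+δᵢⱼ) ∂ϑ/∂τᵢⱼ`; the printed `πi(1+δᵢⱼ)` is this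
`2πi(1+δᵢⱼ)` in the normalisation `Σ exp(πi ᵗnτn + 2πi ᵗnz)`.)
[cite: GrushevskySalvatiManni2008, Dsc 8 (p0005 of the held text)] [cite: LangeBirkenhake1992, §3.3.2 Prop. 3.3.7] -/
theorem hessian_riemannThetaChar_eq_smul_dOp (Ω : Matrix (Fin g) (Fin g) ℂ) (hΩ : ∀ i j, Ω i j = Ω j i)
    {c : ℝ} (hc : 0 < c)
    (hY : ∀ x : Fin g → ℝ, c * ∑ i, x i ^ 2 ≤ ∑ i, ∑ j, x i * (Ω i j).im * x j)
    (a b z : Fin g → ℂ) :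
    (Matrix.of fun i j : Fin g ↦ fderiv ℂ (fun w ↦ fderiv ℂ (riemannThetaChar a b Ω) w
        (Pi.single i (1 : ℂ))) z (Pi.single j (1 : ℂ))) =
      (4 * π * I) • dOp (fun Ω' ↦ riemannThetaChar a b Ω' z) Ω := by
  ext i j
  rw [Matrix.of_apply, Matrix.smul_apply, smul_eq_mul, dOp_apply,
    riemannThetaChar_heat_equation_single_add_single Ω hΩ hc hY a b z j i,
    add_comm (Matrix.single j i (1 : ℂ))]
  ring

/-- **Dsc 8, entrywise**: `∂ᵢ∂ⱼϑ[a;b](·,Ω)(z) = 4πi · 𝒟(ϑ[a;b](z,·))(Ω)ᵢⱼ`.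
[cite: GrushevskySalvatiManni2008, Dsc 8 (p0005 of the held text)] [cite: LangeBirkenhake1992, §3.3.2 Prop. 3.3.7] -/
theorem fderiv_fderiv_riemannThetaChar_eq_mul_dOp (Ω : Matrix (Fin g) (Fin g) ℂ)
    (hΩ : ∀ i j, Ω i j = Ω j i) {c : ℝ} (hc : 0 < c)
    (hY : ∀ x : Fin g → ℝ, c * ∑ i, x i ^ 2 ≤ ∑ i, ∑ j, x i * (Ω i j).im * x j)
    (a b z : Fin g → ℂ) (i j : Fin g) :
    fderiv ℂ (fun w ↦ fderiv ℂ (riemannThetaChar a b Ω) w (Pi.single i (1 : ℂ))) z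
        (Pi.single j (1 : ℂ)) =
      4 * π * I * dOp (fun Ω' ↦ riemannThetaChar a b Ω' z) Ω i j := by
  have h := congrFun (congrFun (hessian_riemannThetaChar_eq_smul_dOp Ω hΩ hc hY a b z) i) j
  simpa only [Matrix.of_apply, Matrix.smul_apply, smul_eq_mul] using h

/-- **"The rank of the quadric defining the tangent cone at `x` is the rank of the matrix
`𝒟θ[ε,δ](τ, 0)`"**: for symmetric `Ω` with `Im Ω ≥ c > 0` and all `a b z`, the Hessian
`(∂ᵢ∂ⱼϑ[a;b](·,Ω)(z))` and the `τ`-gradient `𝒟(ϑ[a;b](z,·))(Ω)` have the same rank.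
[cite: GrushevskySalvatiManni2008, Dsc 8 (p0005 of the held text)] -/
theorem rank_hessian_riemannThetaChar_eq_rank_dOp (Ω : Matrix (Fin g) (Fin g) ℂ)
    (hΩ : ∀ i j, Ω i j = Ω j i) {c : ℝ} (hc : 0 < c)
    (hY : ∀ x : Fin g → ℝ, c * ∑ i, x i ^ 2 ≤ ∑ i, ∑ j, x i * (Ω i j).im * x j)
    (a b z : Fin g → ℂ) :
    (Matrix.of fun i j : Fin g ↦ fderiv ℂ (fun w ↦ fderiv ℂ (riemannThetaChar a b Ω) w
        (Pi.single i (1 : ℂ))) z (Pi.single j (1 : ℂ))).rank =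
      (dOp (fun Ω' ↦ riemannThetaChar a b Ω' z) Ω).rank := by
  rw [hessian_riemannThetaChar_eq_smul_dOp Ω hΩ hc hY a b z, rank_smul_of_ne_zero]
  exact mul_ne_zero (mul_ne_zero (by norm_num) (ofReal_ne_zero.2 Real.pi_ne_zero)) I_ne_zero

/-- **The Hessian vanishes iff the `τ`-gradient vanishes** (`θ_null^0` in the `τ`-reading): for symmetric
`Ω` with `Im Ω ≥ c > 0`, `(∂ᵢ∂ⱼϑ[a;b](·,Ω)(z)) = 0 ↔ 𝒟(ϑ[a;b](z,·))(Ω) = 0`.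
[cite: GrushevskySalvatiManni2008, Dsc 8 (p0005 of the held text)] -/
theorem hessian_riemannThetaChar_eq_zero_iff_dOp_eq_zero (Ω : Matrix (Fin g) (Fin g) ℂ)
    (hΩ : ∀ i j, Ω i j = Ω j i) {c : ℝ} (hc : 0 < c)
    (hY : ∀ x : Fin g → ℝ, c * ∑ i, x i ^ 2 ≤ ∑ i, ∑ j, x i * (Ω i j).im * x j)
    (a b z : Fin g → ℂ) :
    (Matrix.of fun i j : Fin g ↦ fderiv ℂ (fun w ↦ fderiv ℂ (riemannThetaChar a b Ω) w
        (Pi.single i (1 : ℂ))) z (Pi.single j (1 : ℂ))) = 0 ↔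
      dOp (fun Ω' ↦ riemannThetaChar a b Ω' z) Ω = 0 := by
  rw [hessian_riemannThetaChar_eq_smul_dOp Ω hΩ hc hY a b z, smul_eq_zero, or_iff_right]
  exact mul_ne_zero (mul_ne_zero (by norm_num) (ofReal_ne_zero.2 Real.pi_ne_zero)) I_ne_zero

/-- **Dsc 8 on the Siegel upper half space**: for `Ω ∈ 𝔥_g` and all `a b z`,
`(∂ᵢ∂ⱼϑ[a;b](·,Ω)(z))ᵢⱼ = (4πi) • 𝒟(ϑ[a;b](z,·))(Ω)`.
[cite: GrushevskySalvatiManni2008, Dsc 8 (p0005 of the held text)] -/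
theorem hessian_riemannThetaChar_eq_smul_dOp_of_mem_siegelUpperHalfSpace
    {Ω : Matrix (Fin g) (Fin g) ℂ} (hΩ : Ω ∈ siegelUpperHalfSpace g) (a b z : Fin g → ℂ) :
    (Matrix.of fun i j : Fin g ↦ fderiv ℂ (fun w ↦ fderiv ℂ (riemannThetaChar a b Ω) w
        (Pi.single i (1 : ℂ))) z (Pi.single j (1 : ℂ))) =
      (4 * π * I) • dOp (fun Ω' ↦ riemannThetaChar a b Ω' z) Ω := by
  obtain ⟨c, hc, hY⟩ := exists_pos_mul_sum_sq_le_of_posDef_im Ω hΩ.2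
  exact hessian_riemannThetaChar_eq_smul_dOp Ω (fun i j ↦ (hΩ.1.apply i j).symm) hc hY a b z

/-- **The rank equality on `𝔥_g`**: `rank (∂ᵢ∂ⱼϑ[a;b](·,Ω)(z)) = rank 𝒟(ϑ[a;b](z,·))(Ω)` for `Ω ∈ 𝔥_g`.
[cite: GrushevskySalvatiManni2008, Dsc 8 (p0005 of the held text)] -/
theorem rank_hessian_riemannThetaChar_eq_rank_dOp_of_mem_siegelUpperHalfSpace
    {Ω : Matrix (Fin g) (Fin g) ℂ} (hΩ : Ω ∈ siegelUpperHalfSpace g) (a b z : Fin g → ℂ) :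
    (Matrix.of fun i j : Fin g ↦ fderiv ℂ (fun w ↦ fderiv ℂ (riemannThetaChar a b Ω) w
        (Pi.single i (1 : ℂ))) z (Pi.single j (1 : ℂ))).rank =
      (dOp (fun Ω' ↦ riemannThetaChar a b Ω' z) Ω).rank := by
  obtain ⟨c, hc, hY⟩ := exists_pos_mul_sum_sq_le_of_posDef_im Ω hΩ.2
  exact rank_hessian_riemannThetaChar_eq_rank_dOp Ω (fun i j ↦ (hΩ.1.apply i j).symm) hc hY a b z

/-- **Dsc 8 for `ϑ = ϑ[0; 0]`**: `(∂ᵢ∂ⱼϑ(·,Ω)(z))ᵢⱼ = (4πi) • 𝒟(ϑ(z,·))(Ω)` for symmetric `Ω` with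
`Im Ω ≥ c > 0`. [cite: GrushevskySalvatiManni2008, Dsc 8 (p0005 of the held text)]
[cite: LangeBirkenhake1992, §3.3.2 Prop. 3.3.7] -/
theorem hessian_riemannTheta_eq_smul_dOp (Ω : Matrix (Fin g) (Fin g) ℂ) (hΩ : ∀ i j, Ω i j = Ω j i)
    {c : ℝ} (hc : 0 < c)
    (hY : ∀ x : Fin g → ℝ, c * ∑ i, x i ^ 2 ≤ ∑ i, ∑ j, x i * (Ω i j).im * x j)
    (z : Fin g → ℂ) :
    (Matrix.of fun i j : Fin g ↦ fderiv ℂ (fun w ↦ fderiv ℂ (riemannTheta Ω) w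
        (Pi.single i (1 : ℂ))) z (Pi.single j (1 : ℂ))) =
      (4 * π * I) • dOp (fun Ω' ↦ riemannTheta Ω' z) Ω := by
  have h := hessian_riemannThetaChar_eq_smul_dOp Ω hΩ hc hY 0 0 z
  have h0 : riemannThetaChar (0 : Fin g → ℂ) 0 Ω = riemannTheta Ω :=
    funext fun w ↦ riemannThetaChar_zero_zero Ω w
  simp only [riemannThetaChar_zero_zero, h0] at h
  exact h

/-! ### §4 A non-vanishing even theta constant -/

/-- **"There always exists an even characteristic `[ε,δ]` such that `θ[ε,δ](τ) ≠ 0`"** — in fact for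
`Ω` symmetric with `Im Ω` positive definite and EVERY second characteristic `l/2`, `l ∈ ℤ^g`, some
`k ∈ {0,1}^g` has `ϑ[k/2; l/2](0, Ω) ≠ 0`: base-point freeness of `L₀²` (Lange Prop. 2.1.5: the
second-order theta functions `ϑ[k/2; 0](·, Ω)` have no common zero) at the point `v = l/2`, through
`ϑ[a; b](z) = ϑ[a; 0](z + b)`. (Such `[k, l]` is even, odd theta constants being zero.)
[cite: GrushevskySalvatiManni2008, §2 proof of Theorem 9 (p0006 of the held text)]
[cite: Lange2023AbelianVarietiesComplex, §2.1.1 Prop. 2.1.5] -/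
theorem exists_riemannThetaChar_half_ne_zero_snd (Ω : Matrix (Fin g) (Fin g) ℂ)
    (hΩ : ∀ i j, Ω i j = Ω j i) (hpos : (Ω.map Complex.im).PosDef) (l : Fin g → ℤ) :
    ∃ k : Fin g → Fin 2,
      riemannThetaChar (fun i ↦ ((k i : ℕ) : ℂ) / 2) (fun i ↦ (l i : ℂ) / 2) Ω 0 ≠ 0 := by
  obtain ⟨k, hk⟩ := exists_riemannThetaChar_typeD_apply_ne_zero_of_posDef Ω hΩ hpos (fun _ ↦ 2)
    (fun _ ↦ two_ne_zero) (n := 2) le_rfl (fun _ ↦ dvd_rfl) (fun i ↦ (l i : ℂ) / 2)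
  refine ⟨k, fun h0 ↦ hk ?_⟩
  rw [riemannThetaChar_eq_riemannThetaChar_zero_add, zero_add] at h0
  simpa only [Nat.cast_ofNat] using h0

/-- **A non-vanishing theta constant with prescribed second characteristic, integral form**: for
`Ω` symmetric with `Im Ω` positive definite and every `l ∈ ℤ^g` there is `k ∈ ℤ^g` with entries in
`{0, 1}` and `ϑ[k/2; l/2](0, Ω) ≠ 0`. [cite: GrushevskySalvatiManni2008, §2 proof of Theorem 9 (p0006 of the held text)]
[cite: Lange2023AbelianVarietiesComplex, §2.1.1 Prop. 2.1.5] -/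
theorem exists_int_riemannThetaChar_half_ne_zero_snd (Ω : Matrix (Fin g) (Fin g) ℂ)
    (hΩ : ∀ i j, Ω i j = Ω j i) (hpos : (Ω.map Complex.im).PosDef) (l : Fin g → ℤ) :
    ∃ k : Fin g → ℤ, (∀ i, k i = 0 ∨ k i = 1) ∧
      riemannThetaChar (fun i ↦ (k i : ℂ) / 2) (fun i ↦ (l i : ℂ) / 2) Ω 0 ≠ 0 := by
  obtain ⟨k, hk⟩ := exists_riemannThetaChar_half_ne_zero_snd Ω hΩ hpos l
  refine ⟨fun i ↦ ((k i : ℕ) : ℤ), fun i ↦ ?_, ?_⟩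
  · show ((k i : ℕ) : ℤ) = 0 ∨ ((k i : ℕ) : ℤ) = 1
    rcases Fin.exists_fin_two.1 ⟨k i, rfl⟩ with h | h
    · exact Or.inl (by rw [h]; rfl)
    · exact Or.inr (by rw [h]; rfl)
  · simpa only [Int.cast_natCast] using hk

/-- **A non-vanishing theta constant on `𝔥_g`** with prescribed second characteristic.
[cite: GrushevskySalvatiManni2008, §2 proof of Theorem 9 (p0006 of the held text)]
[cite: Lange2023AbelianVarietiesComplex, §2.1.1 Prop. 2.1.5] -/
theorem exists_int_riemannThetaChar_half_ne_zero_snd_of_mem_siegelUpperHalfSpace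
    {Ω : Matrix (Fin g) (Fin g) ℂ} (hΩ : Ω ∈ siegelUpperHalfSpace g) (l : Fin g → ℤ) :
    ∃ k : Fin g → ℤ, (∀ i, k i = 0 ∨ k i = 1) ∧
      riemannThetaChar (fun i ↦ (k i : ℂ) / 2) (fun i ↦ (l i : ℂ) / 2) Ω 0 ≠ 0 :=
  exists_int_riemannThetaChar_half_ne_zero_snd Ω (fun i j ↦ (hΩ.1.apply i j).symm) hΩ.2 l

/-! ### §5 `𝒟ϑ` is the matrix of partial derivatives `∂ϑ/∂Ωᵢⱼ` on all of `M_g(ℂ)` -/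

/-- **The `Ω`-differential of `ϑ[a;b](z, ·)` only sees the symmetric part of the direction**: for
symmetric `Ω` with `Im Ω ≥ c > 0` and every `M ∈ M_g(ℂ)`,
`D_Ω ϑ[a;b](z,·)(Ω)[M] = D_Ω ϑ[a;b](z,·)(Ω)[½(M + ᵗM)]` — the series depends on `Ω` only through the
quadratic form `ᵗ(m+a)Ω(m+a)` (`riemannThetaChar_eq_symmetrize`). [cite: LangeBirkenhake1992, §3.3.2 (3.10) and Prop. 3.3.6] -/
theorem fderiv_riemannThetaChar_omega_apply_eq_symmetrize (Ω : Matrix (Fin g) (Fin g) ℂ)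
    (hΩ : ∀ i j, Ω i j = Ω j i) {c : ℝ} (hc : 0 < c)
    (hY : ∀ x : Fin g → ℝ, c * ∑ i, x i ^ 2 ≤ ∑ i, ∑ j, x i * (Ω i j).im * x j)
    (a b z : Fin g → ℂ) (M : Matrix (Fin g) (Fin g) ℂ) :
    fderiv ℂ (fun Ω' : Matrix (Fin g) (Fin g) ℂ ↦ riemannThetaChar a b Ω' z) Ω M =
      fderiv ℂ (fun Ω' : Matrix (Fin g) (Fin g) ℂ ↦ riemannThetaChar a b Ω' z) Ω
        (Matrix.of fun i j ↦ (M i j + M j i) / 2) := by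
  set f : Matrix (Fin g) (Fin g) ℂ → ℂ := fun Ω' ↦ riemannThetaChar a b Ω' z with hf
  -- the symmetrisation `Ω' ↦ ½(Ω' + ᵗΩ')` as a continuous linear map
  set S : Matrix (Fin g) (Fin g) ℂ →L[ℂ] Matrix (Fin g) (Fin g) ℂ :=
    LinearMap.toContinuousLinearMap ((2⁻¹ : ℂ) •
      (LinearMap.id + (Matrix.transposeLinearEquiv (Fin g) (Fin g) ℂ ℂ).toLinearMap)) with hS
  have hS' : ∀ (Ω' : Matrix (Fin g) (Fin g) ℂ) (i j : Fin g), S Ω' i j = (Ω' i j + Ω' j i) / 2 := by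
    intro Ω' i j
    simp only [hS, LinearMap.coe_toContinuousLinearMap', LinearMap.smul_apply, LinearMap.add_apply,
      LinearMap.id_coe, id_eq, LinearEquiv.coe_coe, Matrix.transposeLinearEquiv_apply,
      AddEquiv.toFun_eq_coe, Matrix.transposeAddEquiv_apply, Matrix.smul_apply, Matrix.add_apply,
      Matrix.transpose_apply, smul_eq_mul]
    ring
  have hSΩ : S Ω = Ω := by
    ext i j
    rw [hS' Ω i j, ← hΩ i j]
    ring
  have hSM : S M = Matrix.of fun i j ↦ (M i j + M j i) / 2 := by
    ext i j
    rw [hS' M i j, Matrix.of_apply]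
  have hdiff : DifferentiableAt ℂ f (S Ω) := by
    rw [hSΩ]
    exact differentiableAt_riemannThetaChar_omega Ω hc hY a b z
  -- `f = f ∘ S`, so `Df(Ω) = Df(SΩ) ∘ S = Df(Ω) ∘ S`
  have key : HasFDerivAt f ((fderiv ℂ f (S Ω)).comp S) Ω :=
    (hdiff.hasFDerivAt.comp Ω S.hasFDerivAt).congr_of_eventuallyEq
      (Filter.Eventually.of_forall fun Ω' ↦ riemannThetaChar_eq_symmetrize a b Ω' (S Ω') (hS' Ω') z)
  have e : fderiv ℂ f Ω M = fderiv ℂ f (S Ω) (S M) := DFunLike.congr_fun key.fderiv M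
  rw [hSΩ, hSM] at e
  exact e

/-- **`(𝒟ϑ)ᵢⱼ = ∂ϑ/∂Ωᵢⱼ`**: for symmetric `Ω` with `Im Ω ≥ c > 0`, the `(i,j)` entry of
`𝒟(ϑ[a;b](z,·))(Ω)` is the partial derivative of `Ω' ↦ ϑ[a;b](z, Ω')` — a function on ALL of
`M_g(ℂ)` — in the direction of the matrix unit `Eᵢⱼ` (`½ D[Eᵢⱼ + Eⱼᵢ] = D[½(Eᵢⱼ + Eⱼᵢ)] = D[Eᵢⱼ]`, the
differential seeing only the symmetric part): GSM's "first derivatives with respect to `τᵢⱼ`" with the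
factors `1`, `½` of `𝒟` built in. [cite: GrushevskySalvatiManni2008, Dsc 8 (p0005 of the held text)]
[cite: LangeBirkenhake1992, §3.3.2 Prop. 3.3.6] -/
theorem dOp_riemannThetaChar_apply_eq_fderiv_single (Ω : Matrix (Fin g) (Fin g) ℂ)
    (hΩ : ∀ i j, Ω i j = Ω j i) {c : ℝ} (hc : 0 < c)
    (hY : ∀ x : Fin g → ℝ, c * ∑ i, x i ^ 2 ≤ ∑ i, ∑ j, x i * (Ω i j).im * x j)
    (a b z : Fin g → ℂ) (i j : Fin g) :
    dOp (fun Ω' ↦ riemannThetaChar a b Ω' z) Ω i j =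
      fderiv ℂ (fun Ω' : Matrix (Fin g) (Fin g) ℂ ↦ riemannThetaChar a b Ω' z) Ω
        (Matrix.single i j (1 : ℂ)) := by
  rw [dOp_apply_eq_fderiv (differentiableAt_riemannThetaChar_omega Ω hc hY a b z),
    fderiv_riemannThetaChar_omega_apply_eq_symmetrize Ω hΩ hc hY a b z (Matrix.single i j 1),
    ← smul_eq_mul, ← map_smul]
  congr 1
  ext i' j'
  have hc : (j = i' ∧ i = j') ↔ (i = j' ∧ j = i') := and_comm
  simp only [Matrix.smul_apply, Matrix.add_apply, Matrix.of_apply, Matrix.single, smul_eq_mul, hc]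
  ring

/-- **`𝒟ϑ(Ω) = 0` iff the whole `Ω`-differential of `ϑ[a;b](z,·)` vanishes at `Ω`** (symmetric `Ω`,
`Im Ω ≥ c > 0`): the vanishing of all first `τ`-derivatives of the theta function at `Ω`.
[cite: GrushevskySalvatiManni2008, Dsc 8 (p0005) and §2 (p0006 of the held text)] -/
theorem dOp_riemannThetaChar_eq_zero_iff_fderiv_eq_zero (Ω : Matrix (Fin g) (Fin g) ℂ)
    (hΩ : ∀ i j, Ω i j = Ω j i) {c : ℝ} (hc : 0 < c)
    (hY : ∀ x : Fin g → ℝ, c * ∑ i, x i ^ 2 ≤ ∑ i, ∑ j, x i * (Ω i j).im * x j)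
    (a b z : Fin g → ℂ) :
    dOp (fun Ω' ↦ riemannThetaChar a b Ω' z) Ω = 0 ↔
      fderiv ℂ (fun Ω' : Matrix (Fin g) (Fin g) ℂ ↦ riemannThetaChar a b Ω' z) Ω = 0 := by
  constructor
  · intro h
    ext M
    rw [Matrix.matrix_eq_sum_single M, map_sum, _root_.zero_apply]
    refine Finset.sum_eq_zero fun i _ ↦ ?_
    rw [map_sum]
    refine Finset.sum_eq_zero fun j _ ↦ ?_
    rw [show Matrix.single i j (M i j) = M i j • Matrix.single i j (1 : ℂ) by
        rw [Matrix.smul_single, smul_eq_mul, mul_one], map_smul,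
      ← dOp_riemannThetaChar_apply_eq_fderiv_single Ω hΩ hc hY a b z i j, h, Matrix.zero_apply,
      smul_zero]
  · intro h
    ext i j
    rw [dOp_riemannThetaChar_apply_eq_fderiv_single Ω hΩ hc hY a b z i j, h,
      _root_.zero_apply, Matrix.zero_apply]

/-- **`(𝒟ϑ)ᵢⱼ = ∂ϑ/∂Ωᵢⱼ` on `𝔥_g`.** [cite: GrushevskySalvatiManni2008, Dsc 8 (p0005 of the held text)] -/
theorem dOp_riemannThetaChar_apply_eq_fderiv_single_of_mem_siegelUpperHalfSpace
    {Ω : Matrix (Fin g) (Fin g) ℂ} (hΩ : Ω ∈ siegelUpperHalfSpace g) (a b z : Fin g → ℂ) (i j : Fin g) :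
    dOp (fun Ω' ↦ riemannThetaChar a b Ω' z) Ω i j =
      fderiv ℂ (fun Ω' : Matrix (Fin g) (Fin g) ℂ ↦ riemannThetaChar a b Ω' z) Ω
        (Matrix.single i j (1 : ℂ)) := by
  obtain ⟨c, hc, hY⟩ := exists_pos_mul_sum_sq_le_of_posDef_im Ω hΩ.2
  exact dOp_riemannThetaChar_apply_eq_fderiv_single Ω (fun i j ↦ (hΩ.1.apply i j).symm) hc hY a b z i j

end Literature.Analysis.SpecialFunctions

end
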